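import Mathlib
import Summits.ResolutionOfSingularities.ResolutionOfSingularities.Theorems.WildQuotientsWildQuotientResolutionToricExitConeVertexIdeal
import Summits.ResolutionOfSingularities.ResolutionOfSingularities.Theorems.WildQuotientsWildQuotientResolutionToricExitConePresentation
import Literature.AlgebraicGeometry.Resolution.MvPolynomialKillVars

/-!
# V3U cone brick, algebra half (2): the vertex ideal under the cone presentation and in the cone quotient

(crux stmt-ResolutionOfSingularities-15640 `WildQuotients.WildQuotientResolution`, line `Sketch`,
sector `|G| = p`; programme V3U of `L/w45c/CHAIN.md` v6.2 §4.0 row stub-3 «HPa THE CONE BRICK» of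
`ToricExit.jordanThree_hasResolution_of_bricks` (p496627). [OURS · L1 W4.5c] — NOT a statement of
any manuscript; replaces the role of no printed item. Prover res-L1-w45c-stub-3.)

* `comap_conePresentation_span_X` — under the cone presentation
  `Ψ : k[y_P, y_Q, y_R, y_c, …] → k[x]` (stub-4, `ToricExit.conePresentation`) the ideal `(x_a, x_b)`
  pulls back to EXACTLY the vertex ideal `(y_P, y_Q, y_R)`: kill the three variables
  (`MvPolynomial.sub_rename_killCompl_mem`); the rest maps injectively modulo `(x_a, x_b)` because
  killing `x_a, x_b` sends `c′ ↦ x_c` and fixes the passengers.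
* `comap_inclusion_span_sq_eq` — in the even subalgebra `E = k[chartAGens]`, the ideal
  `𝔟 = (ρ², ρβ, β²)` meets `k[coneGens]` in the contraction of `(x_a, x_b)`.
* `exists_coneQuotEquiv_map_vertex` — the cone quotient `k[y]/(y_P y_R − y_Q²) ≅ k[coneGens]`
  (first isomorphism theorem on stub-4's C3 `conePresentation_range_ker`, p489405) carries the vertex
  ideal `(y_P, y_Q, y_R)` of stub-4's C4 `JordanThree.cone_affineBlowup_isRegular` (p485904) onto that
  contraction.
-/

-- single-problem summit: the doubled namespace component `ResolutionOfSingularities` is forced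
set_option linter.dupNamespace false

noncomputable section

open MvPolynomial

namespace Summit.ResolutionOfSingularities.ResolutionOfSingularities.Theorems.WildQuotientResolution.ToricExit

/-! ## The vertex ideal under the cone presentation -/

/-- **`(x_a, x_b)` pulls back under the cone presentation to the vertex ideal `(y_P, y_Q, y_R)`.**
`⊇`: `P = x_a²`, `Q = x_a N`, `R = N²` lie in `(x_a, x_b)`. `⊆`: modulo `(y_P, y_Q, y_R)` a
polynomial is a polynomial `F₀` in `y_c` and the passengers (`MvPolynomial.sub_rename_killCompl_mem`),
and `Ψ F₀ ∈ (x_a, x_b)` forces `F₀ = 0`: kill `x_a, x_b` in `k[x]`; this sends `c′ ↦ x_c` and fixes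
the passengers, so `F₀ ↦ F₀(x_c, passengers)`, an injective renaming. [OURS · L1 W4.5c] [folklore] -/
theorem comap_conePresentation_span_X (p : ℕ) (hp3 : 3 ≤ p) (k : Type) [Field k] (n : ℕ)
    (a b c : Fin n) (hab : a ≠ b) (hbc : b ≠ c) (hac : a ≠ c) :
    Ideal.comap (conePresentation k p n a b c)
        (Ideal.span {(X a : MvPolynomial (Fin n) k), X b}) =
      Ideal.span {(X (some a) : MvPolynomial (Option (Fin n)) k), X (some b), X none} := by
  classical
  have hba : b ≠ a := fun h => hab h.symm
  have hca : c ≠ a := fun h => hac h.symm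
  have hcb : c ≠ b := fun h => hbc h.symm
  have hp1 : p - 1 + 1 = p := by omega
  set Ψ := conePresentation k p n a b c with hΨ
  set Ixy : Ideal (MvPolynomial (Fin n) k) := Ideal.span {(X a : MvPolynomial (Fin n) k), X b}
    with hIxy
  set J : Ideal (MvPolynomial (Option (Fin n)) k) :=
    Ideal.span {(X (some a) : MvPolynomial (Option (Fin n)) k), X (some b), X none} with hJ
  have hXa : (X a : MvPolynomial (Fin n) k) ∈ Ixy := Ideal.subset_span (Or.inl rfl)
  have hXb : (X b : MvPolynomial (Fin n) k) ∈ Ixy := Ideal.subset_span (Or.inr rfl)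
  have hN : (X b ^ p - X a ^ (p - 1) * X b : MvPolynomial (Fin n) k) ∈ Ixy := by
    have e0 : (X b ^ p : MvPolynomial (Fin n) k) = X b ^ (p - 1) * X b := by
      rw [← pow_succ, hp1]
    have e : (X b ^ p - X a ^ (p - 1) * X b : MvPolynomial (Fin n) k) =
        (X b ^ (p - 1) - X a ^ (p - 1)) * X b := by
      rw [e0]; ring
    rw [e]
    exact Ideal.mul_mem_left _ _ hXb
  -- `⊇`
  have hsup : J ≤ Ideal.comap Ψ Ixy := by
    rw [hJ, Ideal.span_le]
    rintro y hy
    simp only [Set.mem_insert_iff, Set.mem_singleton_iff] at hy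
    rw [SetLike.mem_coe, Ideal.mem_comap]
    rcases hy with rfl | rfl | rfl
    · rw [hΨ, conePresentation_X_a, sq]
      exact Ideal.mul_mem_left _ _ hXa
    · rw [hΨ, conePresentation_X_b k p n a b c hab]
      exact Ideal.mul_mem_left _ _ hN
    · rw [hΨ, conePresentation_X_none, sq]
      exact Ideal.mul_mem_left _ _ hN
  refine le_antisymm ?_ hsup
  intro F hF
  rw [Ideal.mem_comap] at hF
  -- kill `y_P, y_Q, y_R`
  let T : Set (Option (Fin n)) := {none, some a, some b}
  have hval : Function.Injective (Subtype.val : {o : Option (Fin n) // o ∉ T} → Option (Fin n)) :=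
    Subtype.val_injective
  have hcompl : (Set.range (Subtype.val : {o : Option (Fin n) // o ∉ T} → Option (Fin n)))ᶜ = T :=
    Literature.AlgebraicGeometry.Resolution.MvPolynomial.compl_range_val_not_mem T
  have hJT : Ideal.span (X '' (Set.range (Subtype.val : {o : Option (Fin n) // o ∉ T} →
      Option (Fin n)))ᶜ : Set (MvPolynomial (Option (Fin n)) k)) = J := by
    rw [hcompl, hJ]
    congr 1
    ext y
    simp only [T, Set.mem_image, Set.mem_insert_iff, Set.mem_singleton_iff]
    constructor
    · rintro ⟨o, ho, rfl⟩
      rcases ho with rfl | rfl | rfl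
      · exact Or.inr (Or.inr rfl)
      · exact Or.inl rfl
      · exact Or.inr (Or.inl rfl)
    · rintro (rfl | rfl | rfl)
      · exact ⟨some a, Or.inr (Or.inl rfl), rfl⟩
      · exact ⟨some b, Or.inr (Or.inr rfl), rfl⟩
      · exact ⟨none, Or.inl rfl, rfl⟩
  set F₀ : MvPolynomial (Option (Fin n)) k :=
    rename (Subtype.val : {o : Option (Fin n) // o ∉ T} → Option (Fin n))
      (killCompl hval F) with hF₀
  have hdiff : F - F₀ ∈ J := by
    rw [← hJT]
    exact Literature.AlgebraicGeometry.Resolution.MvPolynomial.sub_rename_killCompl_mem hval F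
  -- `Ψ F₀ ∈ (x_a, x_b)`
  have hΨF₀ : Ψ F₀ ∈ Ixy := by
    have h1 : Ψ (F - F₀) ∈ Ixy := hsup hdiff
    rw [map_sub] at h1
    have h2 : Ψ F₀ = Ψ F - (Ψ F - Ψ F₀) := by ring
    rw [h2]
    exact Ideal.sub_mem _ hF h1
  -- kill `x_a, x_b` in `k[x]`
  let ev : MvPolynomial (Fin n) k →ₐ[k] MvPolynomial (Fin n) k :=
    aeval fun i => if i = a ∨ i = b then 0 else X i
  have heva : ev (X a) = 0 := by simp [ev]
  have hevb : ev (X b) = 0 := by simp [ev]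
  have hevi : ∀ i, i ≠ a → i ≠ b → ev (X i) = X i := fun i hia hib => by simp [ev, hia, hib]
  have hevI : ∀ g ∈ Ixy, ev g = 0 := by
    intro g hg
    have hle : Ixy ≤ RingHom.ker (ev : MvPolynomial (Fin n) k →+* MvPolynomial (Fin n) k) := by
      rw [hIxy, Ideal.span_le]
      rintro y hy
      simp only [Set.mem_insert_iff, Set.mem_singleton_iff] at hy
      rw [SetLike.mem_coe, RingHom.mem_ker]
      rcases hy with rfl | rfl
      · exact heva
      · exact hevb
    exact hle hg
  -- the retraction `λ : k[x] → k[y_o : o ∉ T]`, `x_i ↦ y_{some i}`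
  let lam : MvPolynomial (Fin n) k →ₐ[k] MvPolynomial {o : Option (Fin n) // o ∉ T} k :=
    aeval fun i => if h : (some i : Option (Fin n)) ∉ T then X ⟨some i, h⟩ else 0
  have hcomp : (lam.comp (ev.comp (Ψ.comp (rename (Subtype.val :
      {o : Option (Fin n) // o ∉ T} → Option (Fin n)))))) = AlgHom.id k _ := by
    refine MvPolynomial.algHom_ext fun o => ?_
    obtain ⟨o, ho⟩ := o
    simp only [AlgHom.comp_apply, rename_X, AlgHom.id_apply]
    rcases o with _ | i
    · exact absurd (Or.inl rfl) ho
    · have hia : i ≠ a := by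
        rintro rfl
        exact ho (Set.mem_insert_of_mem _ (Set.mem_insert _ _))
      have hib : i ≠ b := by
        rintro rfl
        exact ho (Set.mem_insert_of_mem _ (Set.mem_insert_of_mem _ (Set.mem_singleton _)))
      have h1 : ev (Ψ (X (some i))) = X i := by
        by_cases hic : i = c
        · subst hic
          rw [hΨ, conePresentation_X_c k p n a b i hac hbc]
          simp [map_sub, map_mul, map_pow, heva, hevb, hevi i hia hib]
        · rw [hΨ, conePresentation_X_of_ne k p n a b c i hia hib hic, hevi i hia hib]
      rw [h1]
      change aeval _ (X i) = _
      rw [aeval_X, dif_pos ho]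
  have hkill : killCompl hval F = 0 := by
    have h1 : lam (ev (Ψ F₀)) = killCompl hval F := by
      have := DFunLike.congr_fun hcomp (killCompl hval F)
      simpa only [AlgHom.comp_apply, AlgHom.id_apply] using this
    rw [← h1, hevI _ hΨF₀, map_zero]
  have hF₀0 : F₀ = 0 := by rw [hF₀, hkill, map_zero]
  rw [hF₀0, sub_zero] at hdiff
  exact hdiff

/-! ## The vertex ideal inside the even subalgebra and in the cone quotient -/

/-- **The ideal `𝔟 = (ρ², ρβ, β²)` of the even subalgebra meets the cone algebra in the contraction
of `(x_a, x_b)`**: `𝔟 ⊆ (x_a, x_b) k[x]`, and conversely an element of `k[coneGens] ∩ (x_a, x_b)`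
is the image of a polynomial in the vertex ideal `(y_P, y_Q, y_R)`
(`comap_conePresentation_span_X`), whose generators go to `ρ²`, `ρβ · D`, `β² · D²` with
`D = β^{p−1} − ρ^{p−1} = (β²)^{(p−1)/2} − (ρ²)^{(p−1)/2} ∈ E`. [OURS · L1 W4.5c] [folklore] -/
theorem comap_inclusion_span_sq_eq (p : ℕ) (hp : p.Prime) (hp3 : 3 ≤ p) (k : Type) [Field k]
    [CharP k p] (n : ℕ) (a b c : Fin n) (hab : a ≠ b) (hbc : b ≠ c) (hac : a ≠ c) :
    Ideal.comap (Subalgebra.inclusion (adjoin_coneGens_le p hp hp3 k n a b c hab hbc hac))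
        (Ideal.span {(⟨X a ^ 2, sq_a_mem_adjoin k n a b⟩ : ↥(Algebra.adjoin k (chartAGens k n a b))),
          ⟨X a * X b, mul_ab_mem_adjoin k n a b⟩, ⟨X b ^ 2, sq_b_mem_adjoin k n a b⟩}) =
      Ideal.comap (Algebra.adjoin k (coneGens k p n a b c)).val
        (Ideal.span {(X a : MvPolynomial (Fin n) k), X b}) := by
  classical
  have h2m := two_mul_half_pred p hp hp3
  have hp1 : p - 1 + 1 = p := by omega
  have hle := adjoin_coneGens_le p hp hp3 k n a b c hab hbc hac
  obtain ⟨hrange, -⟩ := conePresentation_range_ker p hp hp3 k n a b c hab hbc hac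
  set E := Algebra.adjoin k (chartAGens k n a b) with hE
  set Ec := Algebra.adjoin k (coneGens k p n a b c) with hEc
  set Ψ := conePresentation k p n a b c with hΨ
  set Ixy : Ideal (MvPolynomial (Fin n) k) := Ideal.span {(X a : MvPolynomial (Fin n) k), X b}
    with hIxy
  set gA : ↥E := ⟨X a ^ 2, sq_a_mem_adjoin k n a b⟩ with hgA
  set gAB : ↥E := ⟨X a * X b, mul_ab_mem_adjoin k n a b⟩ with hgAB
  set gB : ↥E := ⟨X b ^ 2, sq_b_mem_adjoin k n a b⟩ with hgB
  set 𝔟 : Ideal ↥E := Ideal.span {gA, gAB, gB} with h𝔟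
  have hXa : (X a : MvPolynomial (Fin n) k) ∈ Ixy := Ideal.subset_span (Or.inl rfl)
  have hXb : (X b : MvPolynomial (Fin n) k) ∈ Ixy := Ideal.subset_span (Or.inr rfl)
  -- `𝔟 ⊆ (x_a, x_b)`
  have h𝔟le : 𝔟 ≤ Ideal.comap E.val Ixy := by
    rw [h𝔟, Ideal.span_le]
    rintro y hy
    simp only [Set.mem_insert_iff, Set.mem_singleton_iff] at hy
    rw [SetLike.mem_coe, Ideal.mem_comap]
    rcases hy with rfl | rfl | rfl
    · change (X a ^ 2 : MvPolynomial (Fin n) k) ∈ Ixy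
      rw [sq]; exact Ideal.mul_mem_left _ _ hXa
    · change (X a * X b : MvPolynomial (Fin n) k) ∈ Ixy
      exact Ideal.mul_mem_left _ _ hXb
    · change (X b ^ 2 : MvPolynomial (Fin n) k) ∈ Ixy
      rw [sq]; exact Ideal.mul_mem_left _ _ hXb
  -- the presentation into `E`
  have hΨmem : ∀ F, Ψ F ∈ E := fun F => by
    have h : Ψ F ∈ Ψ.range := AlgHom.mem_range_self Ψ F
    rw [hrange] at h
    exact hle h
  let ΨE : MvPolynomial (Option (Fin n)) k →ₐ[k] ↥E := AlgHom.codRestrict Ψ E hΨmem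
  have hΨE : ∀ F, ((ΨE F : ↥E) : MvPolynomial (Fin n) k) = Ψ F := fun F => rfl
  -- the vertex generators go into `𝔟`
  have hD : (X b ^ (p - 1) - X a ^ (p - 1) : MvPolynomial (Fin n) k) ∈ E := by
    rw [← h2m, pow_mul, pow_mul]
    exact Subalgebra.sub_mem _ (Subalgebra.pow_mem _ (sq_b_mem_adjoin k n a b) _)
      (Subalgebra.pow_mem _ (sq_a_mem_adjoin k n a b) _)
  have hN : (X b ^ p - X a ^ (p - 1) * X b : MvPolynomial (Fin n) k) =
      X b * (X b ^ (p - 1) - X a ^ (p - 1)) := by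
    rw [mul_sub, ← pow_succ', hp1, mul_comm (X b) (X a ^ (p - 1))]
  have hJle : Ideal.span {(X (some a) : MvPolynomial (Option (Fin n)) k), X (some b), X none} ≤
      Ideal.comap ΨE 𝔟 := by
    rw [Ideal.span_le]
    rintro y hy
    simp only [Set.mem_insert_iff, Set.mem_singleton_iff] at hy
    rw [SetLike.mem_coe, Ideal.mem_comap]
    rcases hy with rfl | rfl | rfl
    · have e : ΨE (X (some a)) = gA := Subtype.ext (by rw [hΨE, hΨ, conePresentation_X_a])
      rw [e]
      exact Ideal.subset_span (Or.inl rfl)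
    · have e : ΨE (X (some b)) = gAB * ⟨_, hD⟩ := by
        apply Subtype.ext
        rw [hΨE, hΨ, conePresentation_X_b k p n a b c hab, hN, Subalgebra.coe_mul, hgAB,
          mul_assoc]
      rw [e]
      exact Ideal.mul_mem_right _ _ (Ideal.subset_span (Or.inr (Or.inl rfl)))
    · have e : ΨE (X none) = gB * (⟨_, hD⟩ * ⟨_, hD⟩) := by
        apply Subtype.ext
        rw [hΨE, hΨ, conePresentation_X_none, hN, mul_pow, Subalgebra.coe_mul, Subalgebra.coe_mul,
          ← pow_two]
      rw [e]
      exact Ideal.mul_mem_right _ _ (Ideal.subset_span (Or.inr (Or.inr rfl)))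
  refine le_antisymm ?_ ?_
  · intro x hx
    have h := h𝔟le (Ideal.mem_comap.mp hx)
    rw [Ideal.mem_comap, Subalgebra.coe_val, Subalgebra.coe_inclusion] at h
    rw [Ideal.mem_comap, Subalgebra.coe_val]
    exact h
  · intro x hx
    rw [Ideal.mem_comap, Subalgebra.coe_val] at hx
    obtain ⟨F, hF⟩ : ∃ F, Ψ F = (x : MvPolynomial (Fin n) k) := by
      have h : (x : MvPolynomial (Fin n) k) ∈ Ψ.range := by rw [hrange]; exact x.2
      exact (AlgHom.mem_range Ψ).mp h
    have hFJ : F ∈ Ideal.span {(X (some a) : MvPolynomial (Option (Fin n)) k), X (some b), X none} := by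
      rw [← comap_conePresentation_span_X p hp3 k n a b c hab hbc hac, Ideal.mem_comap, ← hΨ, hF]
      exact hx
    have e : Subalgebra.inclusion hle x = ΨE F :=
      Subtype.ext (by rw [Subalgebra.coe_inclusion, hΨE, hF])
    rw [Ideal.mem_comap, e]
    exact hJle hFJ

/-- **The cone quotient of C4 is the cone algebra of C2/C3, vertex ideal to vertex ideal.** There
is a ring isomorphism `k[y]/(y_P y_R − y_Q²) ≃ k[coneGens]` (first isomorphism theorem on stub-4's
C3 `conePresentation_range_ker`) carrying the image of `(y_P, y_Q, y_R)` onto the contraction of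
`(x_a, x_b)` (`comap_conePresentation_span_X`). [OURS · L1 W4.5c] [folklore] -/
theorem exists_coneQuotEquiv_map_vertex (p : ℕ) (hp : p.Prime) (hp3 : 3 ≤ p) (k : Type)
    [Field k] [CharP k p] (n : ℕ) (a b c : Fin n) (hab : a ≠ b) (hbc : b ≠ c) (hac : a ≠ c) :
    ∃ Φ : (MvPolynomial (Option (Fin n)) k ⧸ Ideal.span
        {(X (some a) * X none - X (some b) ^ 2 : MvPolynomial (Option (Fin n)) k)}) ≃+*
          ↥(Algebra.adjoin k (coneGens k p n a b c)),
      Ideal.map (Φ : _ →+* ↥(Algebra.adjoin k (coneGens k p n a b c)))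
        (Ideal.map (Ideal.Quotient.mk (Ideal.span
          {(X (some a) * X none - X (some b) ^ 2 : MvPolynomial (Option (Fin n)) k)}))
          (Ideal.span {(X (some a) : MvPolynomial (Option (Fin n)) k), X (some b), X none})) =
        Ideal.comap (Algebra.adjoin k (coneGens k p n a b c)).val
          (Ideal.span {(X a : MvPolynomial (Fin n) k), X b}) := by
  classical
  obtain ⟨hrange, hker⟩ := conePresentation_range_ker p hp hp3 k n a b c hab hbc hac
  set Ec := Algebra.adjoin k (coneGens k p n a b c) with hEc
  set Ψ := conePresentation k p n a b c with hΨ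
  set rel : MvPolynomial (Option (Fin n)) k := X (some a) * X none - X (some b) ^ 2 with hrel
  set J : Ideal (MvPolynomial (Option (Fin n)) k) :=
    Ideal.span {(X (some a) : MvPolynomial (Option (Fin n)) k), X (some b), X none} with hJ
  have hΨmem : ∀ F, Ψ F ∈ Ec := fun F => by
    have h : Ψ F ∈ Ψ.range := AlgHom.mem_range_self Ψ F
    rw [hrange] at h
    exact h
  let ΨE : MvPolynomial (Option (Fin n)) k →ₐ[k] ↥Ec := AlgHom.codRestrict Ψ Ec hΨmem
  have hΨE : ∀ F, ((ΨE F : ↥Ec) : MvPolynomial (Fin n) k) = Ψ F := fun F => rfl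
  have hsurj : Function.Surjective ΨE := by
    intro y
    have hy : (y : MvPolynomial (Fin n) k) ∈ Ψ.range := by rw [hrange]; exact y.2
    obtain ⟨F, hF⟩ := (AlgHom.mem_range Ψ).mp hy
    exact ⟨F, Subtype.ext (by rw [hΨE, hF])⟩
  have hkerE : RingHom.ker ΨE = Ideal.span {rel} := by
    rw [← hker]
    ext F
    rw [RingHom.mem_ker, RingHom.mem_ker]
    constructor
    · intro h
      rw [← hΨE, h]; rfl
    · intro h
      exact Subtype.ext (by rw [hΨE, h]; rfl)
  let Φ : (MvPolynomial (Option (Fin n)) k ⧸ Ideal.span {rel}) ≃ₐ[k] ↥Ec :=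
    (Ideal.quotientEquivAlgOfEq k hkerE.symm).trans (Ideal.quotientKerAlgEquivOfSurjective hsurj)
  have hΦ : ∀ F, Φ (Ideal.Quotient.mk (Ideal.span {rel}) F) = ΨE F := by
    intro F
    change Ideal.quotientKerAlgEquivOfSurjective hsurj
      (Ideal.quotientEquivAlgOfEq k hkerE.symm (Ideal.Quotient.mk (Ideal.span {rel}) F)) = ΨE F
    rw [Ideal.quotientEquivAlgOfEq_mk, Ideal.quotientKerAlgEquivOfSurjective_mk]
  refine ⟨Φ.toRingEquiv, ?_⟩
  have hcomp : (Φ.toRingEquiv : _ →+* ↥Ec).comp (Ideal.Quotient.mk (Ideal.span {rel})) =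
      (ΨE : MvPolynomial (Option (Fin n)) k →+* ↥Ec) := RingHom.ext fun F => hΦ F
  rw [Ideal.map_map, hcomp]
  apply le_antisymm
  · rw [Ideal.map_le_iff_le_comap]
    intro F hF
    rw [Ideal.mem_comap, Ideal.mem_comap, Subalgebra.coe_val, RingHom.coe_coe, hΨE,
      ← Ideal.mem_comap, hΨ, comap_conePresentation_span_X p hp3 k n a b c hab hbc hac]
    exact hF
  · intro x hx
    rw [Ideal.mem_comap, Subalgebra.coe_val] at hx
    obtain ⟨F, hF⟩ := hsurj x
    have hFJ : F ∈ J := by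
      rw [hJ, ← comap_conePresentation_span_X p hp3 k n a b c hab hbc hac, Ideal.mem_comap, ← hΨ,
        ← hΨE, hF]
      exact hx
    rw [← hF]
    exact Ideal.mem_map_of_mem _ hFJ

end Summit.ResolutionOfSingularities.ResolutionOfSingularities.Theorems.WildQuotientResolution.ToricExit

end
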